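import Summits.CriticalPhenomena.Ising3DConformalLimit.Theorems.FKParityRobustnessIndependentStrandsJoinCrossFatteningDefs
import Summits.CriticalPhenomena.Ising3DConformalLimit.Theorems.FKParityRobustnessIndependentStrandsJoinStubPairSplitAux
import Summits.CriticalPhenomena.Ising3DConformalLimit.Theorems.FKParityRobustnessDepletionBound
import HarnessLib

/-!
# Crux `IndependentStrandsJoin` (stmt-CriticalPhenomena-14625), line `cross-fattening-decoupling` —
# stub `stub_crossPairTree`, step (i): the PAIR FACTORISATION of the second crossed moment

Route `FKParityRobustness`, sub-problem `Ising3DConformalLimit`; `--supports` file of the registered stub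
`stub_crossPairTree` (skeleton `Cruxes/IndependentStrandsJoin/Lines/cross_fattening_decoupling.lean`), over the
line's landed vocabulary `Theorems/FKParityRobustnessIndependentStrandsJoinCrossFatteningDefs.lean`
(`rch cl soup offCl srcClusters crossCount crossMomentSq`).

Setting (every finite graph `G`, every real `t`).  For a `T`-join `F` of `{x, y}` let `K_x(F) = cl F x` be its
SOURCE CLUSTER (the edges of the `F`-component of `x`) and `L_x(F) = soup F x = F ∖ K_x(F)` its SOUP.  For
`F₁ ∈ 𝒯(x₁y₁)`, `F₂ ∈ 𝒯(x₂y₂)` the line CROSSES the soups, `X₁ = {u : x₁ ↝_{K₁ ∪ L₂} u}`,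
`X₂ = {u : x₂ ↝_{K₂ ∪ L₁} u}`, `N_B = #(X₁ ∩ X₂ ∩ B)` (`crossCount`), and the stub `stub_crossPairTree` bounds
the second moment `crossMomentSq = Σ_{F₁,F₂} t^{|F₁|+|F₂|} N_B²` by the product of two Aizenman–Duminil-Copin
tree diagrams.  Its intended proof has three steps: (i) conditional independence of `X₁`, `X₂` given the
source clusters `(K₁, K₂)`, for PAIRS of window points — an exact identity; (ii) hole filling (d = 3, open);
(iii) ADC2021 Prop. A.3 (in print).  THIS FILE PROVES STEP (i):

  `crossMomentSq G t x₁ y₁ x₂ y₂ B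
     = Σ_{K₁ ∈ 𝒦(x₁;x₁y₁)} Σ_{K₂ ∈ 𝒦(x₂;x₂y₂)} t^{|K₁|+|K₂|}
         Σ_{v,w ∈ B} A(x₁; K₁ | K₂; v, w) · A(x₂; K₂ | K₁; v, w)`,                    (`crossMomentSq_eq_clusterSum`)

with `𝒦(x;S) = srcClusters G x S` (the self-clustered `T`-joins of `S`) and the PAIR ATTACHMENT MASSES
`A(x₁; K₁ | K₂; v, w) = Σ_{L ∈ 𝓔_∅(G − V(K₂))} t^{|L|} 1[x₁ ↝_{K₁ ∪ L} v ∧ x₁ ↝_{K₁ ∪ L} w]` written out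
(`𝓔_∅(G − V(K)) = tJoins G (offCl K x) ∅`).  Dividing by `Z^{x₁y₁} Z^{x₂y₂}` this is
`E[N_B²] = Σ_{v,w ∈ B} E[ P[v,w ∈ X₁ | K₁,K₂] · P[v,w ∈ X₂ | K₁,K₂] ]`.

Proof.  `F ↦ (K_x(F), F ∖ K_x(F))` is a bijection from `𝒯(xy)` onto
`{(K, R) : K ∈ 𝒦(x;xy), R ∈ 𝓔_∅(G − V(K))}` with `|F| = |K| + |R|`: the `x`-cluster of a `T`-join of `{x,y}`
is a self-clustered `T`-join of `{x,y}` inside `E(G)` (`DepletionBound.cluster_props`), the configuration sum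
is partitioned by the cluster value (`Finset.sum_fiberwise_of_maps_to`), and on each fibre the tree's fibre
bijection `stub_pairSplitAux` = `StubPairSplit.fibre_sum` (with `S₀ = {x,y}`, `T = ∅`) applies once its index
set `{R ⊆ edgesIn G Λ_K : oddVerts Λ_K R = ∅}` is identified with `tJoins G (offCl K x) ∅`
(`pairTree_offJoins_eq`); this is `pairTree_sum_tJoins_pair_eq`, applied to both copies.  On the image,
`cl (K ∪ R) x = K`, `soup (K ∪ R) x = R`, `|K ∪ R| = |K| + |R|` (`pairTree_union_props`), so `X₁` is a function of
`(K₁, R₂)` and `X₂` of `(K₂, R₁)`; expanding `N_B² = Σ_{v,w ∈ B} 1[v,w ∈ X₁] 1[v,w ∈ X₂]`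
(`pairTree_card_filter_sq`) the quadruple sum factorises (Fubini, `pairTree_sum_comm₄`).

Theorem-only file (no new definitions).  Helper namespace `…Theorems.StubCrossPairTree` (prefix `pairTree_`).
References: M. Aizenman, H. Duminil-Copin, Ann. of Math. 194 (2021), arXiv:1912.07973, Lemma 4.4 and Prop. A.3
[AizenmanDuminilCopinAnnals2021]; U. T. Hansen, J. Jiang, F. R. Klausen, arXiv:2506.10765, §2 (sourced loop O(1),
`T`-joins) [HansenJiangKlausen2025]; M. Aizenman, Comm. Math. Phys. 86 (1982), §5 (conditioning on the cluster of
a source) [AizenmanCMP1982].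
-/

noncomputable section

open Finset SimpleGraph
open Literature.Probability.LatticeModels

namespace Summit.CriticalPhenomena.Ising3DConformalLimit.Theorems

namespace StubCrossPairTree

open Summit.CriticalPhenomena.Ising3DConformalLimit.Cruxes.IndependentStrandsJoin.CrossFatteningDecoupling
open scoped Classical BigOperators

variable {V : Type*} [Fintype V] [DecidableEq V]

/-- The line's source cluster `cl F x` is the tree's `x`-cluster `{d ∈ F | ∃ w ∈ d, x ↝_F w}`
(`Theorems/…StubPairSplitAux`, `Theorems/…DepletionBoundClusters`); the two `Finset.filter` terms differ
only in the decidability instance of the predicate. -/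
theorem pairTree_cl_eq (F : Finset (Sym2 V)) (x : V) :
    cl F x = F.filter (fun d : Sym2 V =>
      ∃ w ∈ d, (SimpleGraph.fromEdgeSet (↑F : Set (Sym2 V))).Reachable x w) := by
  ext e
  simp only [cl, Finset.mem_filter]

variable (G : SimpleGraph V) [DecidableRel G.Adj]

/-- The even subgraphs of the depleted domain `offCl K x = E(G − V(K))` are exactly the edge sets
`R ⊆ edgesIn G Λ_K` with `oddVerts Λ_K R = ∅`, `Λ_K = {w | ¬ x ↝_K w}` — the index set of the fibre
bijection `stub_pairSplitAux` with `T = ∅`. -/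
theorem pairTree_offJoins_eq (K : Finset (Sym2 V)) (x : V) :
    (edgesIn G (Finset.univ.filter fun w : V =>
          ¬ (SimpleGraph.fromEdgeSet (↑K : Set (Sym2 V))).Reachable x w)).powerset.filter
        (fun R : Finset (Sym2 V) => oddVerts (Finset.univ.filter fun w : V =>
          ¬ (SimpleGraph.fromEdgeSet (↑K : Set (Sym2 V))).Reachable x w) R = ∅)
      = tJoins G (offCl K x) ∅ := by
  ext R
  simp only [Finset.mem_filter, Finset.mem_powerset, mem_tJoins, Finset.notMem_empty, iff_false]
  constructor
  · rintro ⟨hRE, hodd⟩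
    have hRE' : ∀ e ∈ R, e ∈ G.edgeSet ∧
        ∀ v ∈ e, ¬ (SimpleGraph.fromEdgeSet (↑K : Set (Sym2 V))).Reachable x v := fun e he =>
      ⟨(mem_edgesIn_iff.1 (hRE he)).1,
        fun v hv => StubPairSplit.mem_dVol.1 ((mem_edgesIn_iff.1 (hRE he)).2 v hv)⟩
    refine ⟨fun e he => SimpleGraph.mem_edgeFinset.2 (hRE' e he).1,
      fun e he => (hRE' e (Finset.mem_coe.1 he)).2, fun v hv => ?_⟩
    by_cases hxv : (SimpleGraph.fromEdgeSet (↑K : Set (Sym2 V))).Reachable x v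
    · have h0 : #(R.filter (fun e => v ∈ e)) = 0 :=
        StubPairSplit.edeg_eq_zero_of_avoid fun e he hve => (hRE' e he).2 v hve hxv
      rw [h0] at hv
      exact Nat.not_odd_zero hv
    · have hmem : v ∈ oddVerts (Finset.univ.filter fun w : V =>
          ¬ (SimpleGraph.fromEdgeSet (↑K : Set (Sym2 V))).Reachable x w) R :=
        Finset.mem_filter.2 ⟨StubPairSplit.mem_dVol.2 hxv, hv⟩
      rw [hodd] at hmem
      exact Finset.notMem_empty v hmem
  · rintro ⟨hRG, hRoff, hodd⟩
    refine ⟨fun e he => mem_edgesIn_iff.2 ⟨SimpleGraph.mem_edgeFinset.1 (hRG he),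
      fun v hv => StubPairSplit.mem_dVol.2 (hRoff (Finset.mem_coe.2 he) v hv)⟩, ?_⟩
    unfold oddVerts
    rw [Finset.filter_eq_empty_iff]
    exact fun v _ hv => hodd v hv

/-- **Fibring the `T`-joins of a pair over their source cluster.**  For every `φ`,
`Σ_{F ∈ 𝒯(xy)} φ F = Σ_{K ∈ 𝒦(x;xy)} Σ_{R ∈ 𝓔_∅(G − V(K))} φ (K ∪ R)`: the map `F ↦ (K_x(F), F ∖ K_x(F))`
is a bijection from the `T`-joins of `{x, y}` onto the pairs (source cluster, even subgraph of the
depleted domain) — `DepletionBound.cluster_props` (the cluster is a self-clustered `T`-join of `{x,y}`),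
`Finset.sum_fiberwise_of_maps_to`, and the tree's fibre bijection `StubPairSplit.fibre_sum` =
`stub_pairSplitAux` with `S₀ = {x, y}`, `T = ∅`. -/
theorem pairTree_sum_tJoins_pair_eq (x y : V) (φ : Finset (Sym2 V) → ℝ) :
    ∑ F ∈ tJoins G Set.univ {x, y}, φ F =
      ∑ K ∈ srcClusters G x {x, y}, ∑ R ∈ tJoins G (offCl K x) ∅, φ (K ∪ R) := by
  have hmaps : ∀ F ∈ tJoins G Set.univ {x, y}, cl F x ∈ srcClusters G x {x, y} := by
    intro F hF
    obtain ⟨h1, h2, h3⟩ := DepletionBound.cluster_props G hF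
    rw [srcClusters, Finset.mem_filter, pairTree_cl_eq F x, pairTree_cl_eq,
      StubPairSplit.mem_tJoins_univ]
    exact ⟨⟨h1, h3⟩, h2⟩
  rw [← Finset.sum_fiberwise_of_maps_to hmaps φ]
  refine Finset.sum_congr rfl fun K hK => ?_
  rw [srcClusters, Finset.mem_filter, StubPairSplit.mem_tJoins_univ] at hK
  obtain ⟨⟨hKG, hKodd⟩, hKself⟩ := hK
  rw [pairTree_cl_eq] at hKself
  have h := StubPairSplit.fibre_sum G hKG hKself hKodd (T := ∅) (Finset.empty_subset _) φ
  rw [Finset.union_empty, pairTree_offJoins_eq] at h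
  rw [← h]
  refine Finset.sum_congr ?_ fun _ _ => rfl
  refine Finset.filter_congr fun F _ => ?_
  rw [pairTree_cl_eq]

/-- **Gluing a source cluster and a soup.**  For `K ∈ 𝒦(x;S)` and an even subgraph `R` of the depleted
domain `offCl K x`: the `x`-cluster of `K ∪ R` is `K`, its soup is `R`, and `|K ∪ R| = |K| + |R|`
(`StubPairSplit.cluster_union_eq`, `StubPairSplit.disjoint_of_avoid`). -/
theorem pairTree_union_props {x : V} {S : Finset V} {K R : Finset (Sym2 V)}
    (hK : K ∈ srcClusters G x S) (hR : R ∈ tJoins G (offCl K x) ∅) :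
    cl (K ∪ R) x = K ∧ soup (K ∪ R) x = R ∧ #(K ∪ R) = #K + #R := by
  have hKself : K.filter (fun d : Sym2 V =>
      ∃ w ∈ d, (SimpleGraph.fromEdgeSet (↑K : Set (Sym2 V))).Reachable x w) = K := by
    rw [← pairTree_cl_eq]
    rw [srcClusters, Finset.mem_filter] at hK
    exact hK.2
  have havoid : ∀ e ∈ R, ∀ v ∈ e, ¬ (SimpleGraph.fromEdgeSet (↑K : Set (Sym2 V))).Reachable x v :=
    fun e he => ((mem_tJoins G).1 hR).2.1 (Finset.mem_coe.2 he)
  have hdisj : Disjoint K R := StubPairSplit.disjoint_of_avoid hKself havoid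
  have hcl : cl (K ∪ R) x = K := by
    rw [pairTree_cl_eq]
    exact StubPairSplit.cluster_union_eq hKself havoid
  refine ⟨hcl, ?_, Finset.card_union_of_disjoint hdisj⟩
  unfold soup
  rw [hcl]
  exact Finset.union_sdiff_cancel_left hdisj

omit [Fintype V] [DecidableEq V] in
/-- `#{u ∈ B | P u}² = Σ_{v,w ∈ B} 1[P v ∧ P w]` (over `ℝ`). -/
theorem pairTree_card_filter_sq {α : Type*} (B : Finset α) (P : α → Prop) [DecidablePred P] :
    ((#(B.filter P) : ℕ) : ℝ) ^ 2 = ∑ v ∈ B, ∑ w ∈ B, if P v ∧ P w then (1 : ℝ) else 0 := by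
  rw [Finset.natCast_card_filter, sq, Finset.sum_mul_sum]
  refine Finset.sum_congr rfl fun v _ => Finset.sum_congr rfl fun w _ => ?_
  rw [ite_zero_mul_ite_zero, one_mul]

omit [Fintype V] [DecidableEq V] in
/-- Reordering a quadruple sum: `Σ_a Σ_b Σ_c Σ_d = Σ_c Σ_d Σ_b Σ_a`. -/
theorem pairTree_sum_comm₄ {α β γ δ : Type*} (s : Finset α) (t : Finset β) (u : Finset γ)
    (r : Finset δ) (f : α → β → γ → δ → ℝ) :
    ∑ a ∈ s, ∑ b ∈ t, ∑ c ∈ u, ∑ d ∈ r, f a b c d =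
      ∑ c ∈ u, ∑ d ∈ r, ∑ b ∈ t, ∑ a ∈ s, f a b c d :=
  calc ∑ a ∈ s, ∑ b ∈ t, ∑ c ∈ u, ∑ d ∈ r, f a b c d
      = ∑ a ∈ s, ∑ c ∈ u, ∑ b ∈ t, ∑ d ∈ r, f a b c d :=
        Finset.sum_congr rfl fun _ _ => Finset.sum_comm
    _ = ∑ c ∈ u, ∑ a ∈ s, ∑ b ∈ t, ∑ d ∈ r, f a b c d := Finset.sum_comm
    _ = ∑ c ∈ u, ∑ a ∈ s, ∑ d ∈ r, ∑ b ∈ t, f a b c d :=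
        Finset.sum_congr rfl fun _ _ => Finset.sum_congr rfl fun _ _ => Finset.sum_comm
    _ = ∑ c ∈ u, ∑ d ∈ r, ∑ a ∈ s, ∑ b ∈ t, f a b c d :=
        Finset.sum_congr rfl fun _ _ => Finset.sum_comm
    _ = ∑ c ∈ u, ∑ d ∈ r, ∑ b ∈ t, ∑ a ∈ s, f a b c d :=
        Finset.sum_congr rfl fun _ _ => Finset.sum_congr rfl fun _ _ => Finset.sum_comm

end StubCrossPairTree

/-! ### The pair factorisation identity -/

open Summit.CriticalPhenomena.Ising3DConformalLimit.Cruxes.IndependentStrandsJoin.CrossFatteningDecoupling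
open StubCrossPairTree

/-- **Pair factorisation of the second crossed moment (conditional independence of the crossed
clusters given the source clusters, for PAIRS of window points).**  On every finite graph, for every
real `t`, sources `{x₁, y₁}`, `{x₂, y₂}` and window `B`:
`Σ_{F₁ ∈ 𝒯(x₁y₁)} Σ_{F₂ ∈ 𝒯(x₂y₂)} t^{|F₁|+|F₂|} N_B(F₁,F₂)²
  = Σ_{K₁ ∈ 𝒦(x₁;x₁y₁)} Σ_{K₂ ∈ 𝒦(x₂;x₂y₂)} t^{|K₁|+|K₂|} Σ_{v,w ∈ B} A(x₁;K₁|K₂;v,w) · A(x₂;K₂|K₁;v,w)`,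
with the PAIR attachment masses `A(x₁;K₁|K₂;v,w) = Σ_{L ∈ 𝓔_∅(G − V(K₂))} t^{|L|} 1[x₁ ↝_{K₁∪L} v, x₁ ↝_{K₁∪L} w]`
written out.  Proof: fibre both configuration sums over the source clusters
(`StubCrossPairTree.pairTree_sum_tJoins_pair_eq`, i.e. the tree's fibre bijection `stub_pairSplitAux`
on both copies), so that `F_i = K_i ∪ R_i` with `cl F_i x_i = K_i`, `soup F_i x_i = R_i`,
`|F_i| = |K_i| + |R_i|` (`pairTree_union_props`); then `X₁ = C(x₁; K₁ ∪ R₂)` depends on `(K₁, R₂)` only and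
`X₂ = C(x₂; K₂ ∪ R₁)` on `(K₂, R₁)` only, `N_B² = Σ_{v,w ∈ B} 1[v,w ∈ X₁] 1[v,w ∈ X₂]`
(`pairTree_card_filter_sq`), and the quadruple sum factorises (Fubini).  Step (i) of the intended proof
of the registered stub `stub_crossPairTree` (line `cross-fattening-decoupling` of crux
`IndependentStrandsJoin`, stmt-CriticalPhenomena-14625); the pair analogue of `stub_crossFactorisation`. -/
theorem crossMomentSq_eq_clusterSum :
    ∀ (V : Type) [Fintype V] [DecidableEq V] (G : SimpleGraph V) [DecidableRel G.Adj] (t : ℝ)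
      (x₁ y₁ x₂ y₂ : V) (B : Finset V),
      crossMomentSq G t x₁ y₁ x₂ y₂ B
        = ∑ K₁ ∈ srcClusters G x₁ {x₁, y₁}, ∑ K₂ ∈ srcClusters G x₂ {x₂, y₂}, t ^ (#K₁ + #K₂) *
            ∑ v ∈ B, ∑ w ∈ B,
              (∑ L ∈ tJoins G (offCl K₂ x₂) ∅,
                  if rch (K₁ ∪ L) x₁ v ∧ rch (K₁ ∪ L) x₁ w then t ^ #L else 0) *
              (∑ L ∈ tJoins G (offCl K₁ x₁) ∅,
                  if rch (K₂ ∪ L) x₂ v ∧ rch (K₂ ∪ L) x₂ w then t ^ #L else 0) := by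
  intro V _ _ G _ t x₁ y₁ x₂ y₂ B
  unfold crossMomentSq
  rw [pairTree_sum_tJoins_pair_eq G x₁ y₁]
  refine Finset.sum_congr rfl fun K₁ hK₁ => ?_
  simp_rw [pairTree_sum_tJoins_pair_eq G x₂ y₂]
  rw [Finset.sum_comm (s := tJoins G (offCl K₁ x₁) ∅) (t := srcClusters G x₂ {x₂, y₂})]
  refine Finset.sum_congr rfl fun K₂ hK₂ => ?_
  have h2 : ∀ R₁ ∈ tJoins G (offCl K₁ x₁) ∅, ∀ R₂ ∈ tJoins G (offCl K₂ x₂) ∅,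
      t ^ (#(K₁ ∪ R₁) + #(K₂ ∪ R₂)) * (crossCount x₁ x₂ B (K₁ ∪ R₁) (K₂ ∪ R₂) : ℝ) ^ 2
        = ∑ v ∈ B, ∑ w ∈ B, t ^ (#K₁ + #K₂) *
            ((if rch (K₁ ∪ R₂) x₁ v ∧ rch (K₁ ∪ R₂) x₁ w then t ^ #R₂ else 0) *
             (if rch (K₂ ∪ R₁) x₂ v ∧ rch (K₂ ∪ R₁) x₂ w then t ^ #R₁ else 0)) := by
    intro R₁ hR₁ R₂ hR₂
    obtain ⟨hcl₁, hsoup₁, hcard₁⟩ := pairTree_union_props G hK₁ hR₁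
    obtain ⟨hcl₂, hsoup₂, hcard₂⟩ := pairTree_union_props G hK₂ hR₂
    rw [crossCount, hcl₁, hsoup₁, hcl₂, hsoup₂, hcard₁, hcard₂, pairTree_card_filter_sq,
      Finset.mul_sum]
    refine Finset.sum_congr rfl fun v _ => ?_
    rw [Finset.mul_sum]
    refine Finset.sum_congr rfl fun w _ => ?_
    rw [ite_zero_mul_ite_zero]
    by_cases h : (rch (K₁ ∪ R₂) x₁ v ∧ rch (K₁ ∪ R₂) x₁ w) ∧
        (rch (K₂ ∪ R₁) x₂ v ∧ rch (K₂ ∪ R₁) x₂ w)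
    · rw [if_pos h, if_pos ⟨⟨h.1.1, h.2.1⟩, h.1.2, h.2.2⟩]
      ring
    · rw [if_neg h, if_neg (fun h' => h ⟨⟨h'.1.1, h'.2.1⟩, h'.1.2, h'.2.2⟩)]
      ring
  rw [Finset.sum_congr rfl fun R₁ hR₁ => Finset.sum_congr rfl fun R₂ hR₂ => h2 R₁ hR₁ R₂ hR₂,
    pairTree_sum_comm₄ (tJoins G (offCl K₁ x₁) ∅) (tJoins G (offCl K₂ x₂) ∅) B B]
  rw [Finset.mul_sum]
  refine Finset.sum_congr rfl fun v _ => ?_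
  rw [Finset.mul_sum]
  refine Finset.sum_congr rfl fun w _ => ?_
  rw [Finset.sum_mul_sum, Finset.mul_sum]
  refine Finset.sum_congr rfl fun R₂ _ => ?_
  rw [Finset.mul_sum]

/-- **Registered auxiliary stub `stub_crossPairTreeFactorisation` of `stub_crossPairTree`** (crux
stmt-CriticalPhenomena-14625, line `cross-fattening-decoupling`; registered signature, verbatim): the pair
factorisation identity.  This is `crossMomentSq_eq_clusterSum`. -/
theorem stub_crossPairTreeFactorisation :
    ∀ (V : Type) [Fintype V] [DecidableEq V] (G : SimpleGraph V) [DecidableRel G.Adj] (t : ℝ)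
      (x₁ y₁ x₂ y₂ : V) (B : Finset V),
      crossMomentSq G t x₁ y₁ x₂ y₂ B
        = ∑ K₁ ∈ srcClusters G x₁ {x₁, y₁}, ∑ K₂ ∈ srcClusters G x₂ {x₂, y₂}, t ^ (#K₁ + #K₂) *
            ∑ v ∈ B, ∑ w ∈ B,
              (∑ L ∈ tJoins G (offCl K₂ x₂) ∅,
                  if rch (K₁ ∪ L) x₁ v ∧ rch (K₁ ∪ L) x₁ w then t ^ #L else 0) *
              (∑ L ∈ tJoins G (offCl K₁ x₁) ∅,
                  if rch (K₂ ∪ L) x₂ v ∧ rch (K₂ ∪ L) x₂ w then t ^ #L else 0) :=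
  crossMomentSq_eq_clusterSum

end Summit.CriticalPhenomena.Ising3DConformalLimit.Theorems

end
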